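import Summits.CriticalPhenomena.SAWScalingLimit.Theses.SAWLaplacianWalk
import Literature.Probability.RandomPlanarGeometry.ObservableDiscretePassage
import Literature.Probability.RandomPlanarGeometry.SLETraceApproximation

/-!
# Birth skeleton (BC3) for the crux `SAWLaplacianWalk.HarmonicPassage`
(crux item stmt-CriticalPhenomena-4482, rank 4 of `route-CriticalPhenomena-SAWLaplacianWalk`; skeleton registrar
planner-skel-stmt-CriticalPhenomena-4482-0, 2026-08-17; tree path
`Summits/CriticalPhenomena/SAWScalingLimit/Cruxes/HarmonicPassage/Lines/birth.lean`.)

Crux (FIXED, by name): `HarmonicPassage` — `TipHarmonicLaw` (K58, the lattice Laplacian-5/8 law) ⇒ for every Dobrushin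
domain `(Ω; a, b)`, endpoint approximation, third boundary point `d₀ ← d_δ`, chordal uniformizing map `φ` with
`φ(x) = d₀`, and every probability subsequential limit `ν` of the SAW curve laws carried by Loewner-describable curves from
`a`: the cylinder identities `E_ν[(N^{x,m}_t − N^{x,m}_s)·ψ(W_{S₁}, …, W_{Sₙ})] = 0` for the harmonic 5/8-observable
`N^x_t = exp(−(5/4)∫₀ᵗ du/(g_u(x) − W_u)²)·|g_t(x) − W_t|^{−5/4}` of `W = drivingFunction φ`, stopped at level `1/(m+1)`
with horizon `m+1`.

## The line: CDHKS-shaped passage for the STOPPED harmonic observable (3 registered stubs)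

The tree already proves the spin-Ising version of "a lattice martingale observable passes to cylinder identities of
every subsequential limit" in two inputs (`Literature/Probability/LatticeModels/InterfaceSLELimitData.lean`:
(J′) the discrete capacity driving processes converge in distribution in `C([0,∞), ℝ)` to the driving function of the
limit; (D) per-scale discrete martingales approximate the continuum observable of the discrete driver) through the
PROVED generic passage theorem `Loewner.integral_cylinder_eq_zero_of_discreteMartingales`
(`RandomPlanarGeometry/ObservableDiscretePassage.lean`: jointly continuous BOUNDED path functional, Doob optional sampling
in pairing form, weak convergence). The harmonic 5/8-observable differs from the spin observable in exactly one respect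
that matters for the passage: it is unbounded near the swallowing of `x`, so it is localised by the HITTING TIME of the
level `|g(x) − W| = 1/(m+1)` — and hitting times are not continuous functionals of the driver path (only at paths that
cross the level; touching paths are discontinuity points). The line isolates the three resulting tasks:

* S1 `stub_latticeHarmonicData` (OPEN, XL; the SAW content, load-bearing): `LatticeHarmonicData` — K58 ⇒ for every
  datum of the crux, `HarmonicLimitData φ x ν`: probability spaces carrying continuous-path processes `V^k` converging in
  distribution to `drivingFunction φ` under `ν` (Kemppainen–Smirnov JOINT convergence for the critical SAW along the
  subsequence — the part of KS17 Cor. 1.7 that the route's `LimitsDescribable` does not retain), and, for EVERY real level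
  `ℓ > 0`, horizon `T` and times `s ≤ t`, discrete martingale data (filtration, real martingale `F` = the exact target-tilt
  martingale `M_η = Z_η(d_δ)/Z_η(b_δ)` normalised by `e^{−C_δ}`, `SlitFirstStep` proved; stopping indices `σ ≤ τ ≤ M`;
  a.e. bounds; a bad event of vanishing probability) whose stopped values approximate the STOPPED harmonic observable of
  `V^k` at level `ℓ`, horizon `T` — K58 + discrete potential theory at the tip (SRW hitting ratio from the tip of the slit
  → continuum tip kernel `g′(x)/(g(x) − W)²`) + uniform integrability of the tilt martingale.
* S2 `stub_genericLevelPassage` (provable in kind, L/XL; the harmonic analogue of the tree's spin passage theorem):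
  `GenericLevelPassage` — `HarmonicLimitData φ x ν` ⇒ for every horizon `T`, all but COUNTABLY many levels `ℓ > 0` satisfy
  the cylinder identity `CylinderIdentityAt φ x ν ℓ T` (for each driver law the level-`ℓ` hitting time is an a.s.
  continuity point of the path functional except for the countably many `ℓ` where `ℓ ↦ E[arctan τ_ℓ]` jumps; continuity
  of the Loewner flow in the driver, `LoewnerDriverStability`; an a.e.-continuous mapping theorem from the closed-set
  portmanteau, cf. `Process/AlmostContinuousMapping.lean`; truncation of the functional; then the tree's
  `integral_cylinder_eq_zero_of_discreteMartingales` argument).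
* S3 `stub_levelTransfer` (provable now, M/L): `LevelTransfer` — if the identity holds at levels `ℓ′ ↓ ℓ` (frequently in
  `𝓝[>] ℓ`) then it holds at `ℓ`: `τ_{ℓ′} ↑ τ_ℓ` as `ℓ′ ↓ ℓ` for every continuous driver (time-continuity of the Loewner
  flow of a real point before swallowing, `IsSolution` is an integral curve), the stopped observables converge pointwise
  and are dominated by `2 ℓ^{−5/4}` (`|gap| ≥ ℓ′ > ℓ` up to `τ_{ℓ′}`, the exponential factor is `≤ 1`), measurability of
  `c ↦ N(drivingFunction φ c)` (`measurable_drivingFunction`), dominated convergence.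

Composition `HarmonicPassage_of` (kernel-checked, no `sorry` of its own): S1 gives the data; S2 gives a countable
exceptional set of levels for the horizon `m + 1`; its complement is dense (`Set.Countable.dense_compl`), so good levels
accumulate at `1/(m+1)` from above; S3 transfers the identity to the level `1/(m+1)` itself, which is the crux's
conclusion after ζ-reduction of its four `let`s (the local `gapPath`/`harmonicObs`/`levelTime`/`stoppedObs` are the crux's
`gap`/`N`/`τ` as closed terms).

Negatives honoured: `ledger crux ls stmt-CriticalPhenomena-4482` — no `Disproof.lean`, no dead line for this crux yet
(2026-08-17); `ledger negatives --problem CriticalPhenomena`: no refuted statement concerns driver convergence or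
martingale passage (the refuted all-δ `Tight` of stmt-0772 is not used: everything here is along a subsequence / under
`ν`). The typing respects checklist 4c(ii): every `∫ … ∂ν = 0` conclusion is reached only through hypotheses that make
the integrand measurable and a.e. bounded (S2/S3 carry `D.IsChordalUniformizing φ`, hence `measurable_drivingFunction`).
-/

noncomputable section

namespace Summit.CriticalPhenomena.SAWScalingLimit.Cruxes.HarmonicPassage.Birth

open scoped NNReal ENNReal Topology
open MeasureTheory Filter Set
open UpperHalfPlane (upperHalfPlaneSet)
open Literature.Probability.RandomPlanarGeometry Literature.Probability.LatticeModels
open scoped Literature.Probability.RandomPlanarGeometry.PathBorel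
open Summit.CriticalPhenomena.SAWScalingLimit.Theses.SAWLaplacianWalk (TipHarmonicLaw HarmonicPassage)

set_option linter.unusedVariables false

/-! ## The harmonic 5/8-observable of a driver path (the crux's `gap`, `N`, `τ` as closed terms) -/

/-- The gap `g_t(x) − U_t` of the real point `x` under the chordal Loewner flow driven by `U` (`Loewner.map`, with its
documented junk value `x` after the swallowing time). This is the crux's `gap x t c` for `U = drivingFunction φ c`. -/
def gapPath (U : ℝ≥0 → ℝ) (x : ℝ) (t : ℝ≥0) : ℝ :=
  (Loewner.map U t (x : ℂ)).re - U t

/-- The harmonic 5/8-observable `N^x_t(U) = exp(−(5/4)∫₀ᵗ ds/gap_s²)·|gap_t|^{−5/4} = [g_t′(x)/(g_t(x) − U_t)²]^{5/8}`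
(`∂_t log g_t′(x) = −2/gap_t²`). This is the crux's `N x t c` for `U = drivingFunction φ c`. -/
def harmonicObs (U : ℝ≥0 → ℝ) (x : ℝ) (t : ℝ≥0) : ℝ :=
  Real.exp (-(5 / 4 : ℝ) * ∫ s in (0 : ℝ)..(t : ℝ), 1 / (gapPath U x s.toNNReal) ^ 2) *
    |gapPath U x t| ^ (-(5 / 4 : ℝ))

/-- The localisation time at level `ℓ` with horizon `T`: `inf ({t | |gap_t| ≤ ℓ} ∪ {T})`. The crux's `τ x m c` is the
case `ℓ = 1/(m+1)`, `T = m+1`, `U = drivingFunction φ c`. -/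
def levelTime (U : ℝ≥0 → ℝ) (x ℓ : ℝ) (T : ℝ≥0) : ℝ≥0 :=
  sInf ({t : ℝ≥0 | |gapPath U x t| ≤ ℓ} ∪ {T})

/-- The stopped observable `N^x_{u ∧ τ_{ℓ,T}}(U)`. -/
def stoppedObs (U : ℝ≥0 → ℝ) (x ℓ : ℝ) (T u : ℝ≥0) : ℝ :=
  harmonicObs U x (min u (levelTime U x ℓ T))

variable {D : DobrushinDomain}

/-- **The cylinder identity at level `ℓ`, horizon `T`** for the law `ν` on curve classes, the uniformizing map `φ` and
the real point `x`: for all `s ≤ t`, finitely many times `S ≤ s` and continuous `|ψ| ≤ 1`,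
`E_ν[(N^x_{t∧τ} − N^x_{s∧τ})(W)·ψ(W_S)] = 0`, `W = drivingFunction φ`, `τ = levelTime W x ℓ T`. The crux's conclusion
for the level index `m` is `CylinderIdentityAt φ x ν (1/(m+1)) (m+1)`. -/
def CylinderIdentityAt (φ : ConformalEquiv upperHalfPlaneSet D.carrier) (x : ℝ) (ν : Measure (CurveClass ℂ))
    (ℓ : ℝ) (T : ℝ≥0) : Prop :=
  ∀ (s t : ℝ≥0), s ≤ t → ∀ (n : ℕ) (S : Fin n → ℝ≥0), (∀ k, S k ≤ s) →
    ∀ ψ : (Fin n → ℝ) → ℝ, Continuous ψ → (∀ v, |ψ v| ≤ 1) →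
      ∫ c, (stoppedObs (drivingFunction φ c) x ℓ T t - stoppedObs (drivingFunction φ c) x ℓ T s) *
        ψ (fun k => drivingFunction φ c (S k)) ∂ν = 0

/-! ## The interface between the lattice and the limit: CDHKS-type limit data for the stopped harmonic observable -/

/-- **Harmonic limit data for `(φ, x, ν)`** — the shape of the two printed inputs of CDHKS §3 as consumed by the tree's
generic passage theorem `Loewner.integral_cylinder_eq_zero_of_discreteMartingales`, with the bounded spin observable
replaced by the STOPPED harmonic 5/8-observable at an arbitrary real level `ℓ > 0` and horizon `T`:
(J′) probability spaces `(Ω′ k, P k)` carrying continuous-path real processes `V^k` (the capacity driving processes of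
the lattice SAW curves along a sequence of meshes realising `ν`) converging in distribution in `C([0, ∞), ℝ)` to the
driving function `drivingFunction φ` under `ν`; (D) for every `ℓ > 0`, `T`, `s ≤ t`: a constant `C′`, null sequences
`ε, Δ, η` and, at every scale `k`, a discrete filtration `𝒢`, a real `𝒢`-martingale `F` (the normalised target-tilt
martingale `e^{−C_δ} Z_η(d_δ)/Z_η(b_δ)` of the SAW past), stopping times `σ ≤ τ ≤ M` such that `V^k_u`, `u ≤ s`, is
`𝒢_σ`-measurable, `|F_σ|, |F_τ| ≤ C′` a.e., and off an event of probability `≤ η_k` the stopped values are within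
`ε_k` of the stopped harmonic observable of `V^k` at some time of `[s, s + Δ_k]`, resp. `[t, t + Δ_k]`. -/
def HarmonicLimitData (φ : ConformalEquiv upperHalfPlaneSet D.carrier) (x : ℝ) (ν : Measure (CurveClass ℂ))
    [IsProbabilityMeasure ν] : Prop :=
  ∃ (Ω' : ℕ → Type) (mΩ' : ∀ k, MeasurableSpace (Ω' k)) (P : ∀ k, Measure (Ω' k))
    (hP : ∀ k, IsProbabilityMeasure (P k)) (V : ∀ k, ℝ≥0 → Ω' k → ℝ) (hVc : ∀ k ω, Continuous (V k · ω)),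
    TendstoInDistribution (fun k ω ↦ (⟨fun u ↦ V k u ω, hVc k ω⟩ : C(ℝ≥0, ℝ))) atTop
      (fun c ↦ (⟨drivingFunction φ c, continuous_drivingFunction φ c⟩ : C(ℝ≥0, ℝ))) P ν ∧
    ∀ ℓ : ℝ, 0 < ℓ → ∀ (T s t : ℝ≥0), s ≤ t →
      ∃ (C' : ℝ) (ε Δ η : ℕ → ℝ≥0), Tendsto ε atTop (𝓝 0) ∧ Tendsto Δ atTop (𝓝 0) ∧
        Tendsto η atTop (𝓝 0) ∧
        ∀ k, ∃ (𝒢 : Filtration ℕ (mΩ' k)) (F : ℕ → Ω' k → ℝ) (σ τ : Ω' k → WithTop ℕ)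
          (hσ : IsStoppingTime 𝒢 σ) (M : ℕ) (bad : Set (Ω' k)),
          IsStoppingTime 𝒢 τ ∧ Martingale F 𝒢 (P k) ∧ σ ≤ τ ∧ (∀ ω, τ ω ≤ M) ∧
          (∀ u, u ≤ s → Measurable[hσ.measurableSpace] (V k u)) ∧
          (∀ᵐ ω ∂P k, |stoppedValue F σ ω| ≤ C') ∧ (∀ᵐ ω ∂P k, |stoppedValue F τ ω| ≤ C') ∧
          MeasurableSet bad ∧ P k bad ≤ η k ∧
          ∀ᵐ ω ∂P k, ω ∉ bad →
            (∃ u ∈ Icc s (s + Δ k), |stoppedValue F σ ω - stoppedObs (fun r ↦ V k r ω) x ℓ T u| ≤ ε k) ∧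
            (∃ u ∈ Icc t (t + Δ k), |stoppedValue F τ ω - stoppedObs (fun r ↦ V k r ω) x ℓ T u| ≤ ε k)

/-! ## Statements of the line -/

/-- **(S1) Lattice harmonic data.** `TipHarmonicLaw` (K58) ⇒ for every datum of the crux — Dobrushin domain, endpoint
approximation, third boundary point `d₀ ← d_δ` joined to `a_δ`, chordal uniformizing `φ` with `φ(x) = d₀`, and a
probability subsequential limit `ν` of the SAW curve laws carried by describable curves from `a` — the limit data
`HarmonicLimitData φ x ν` exist. Content: KS joint convergence of (curve, driver) for the critical SAW along the
subsequence; the exact target-tilt martingale (`SlitFirstStep`, proved); K58; discrete potential theory at the tip of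
the slit (SRW hitting ratio → `g′(x)/(g(x) − W)²` through `φ`, boundary value `x ↦ d₀`); uniform integrability of the
tilt martingale at the localisation indices. -/
def LatticeHarmonicData : Prop :=
  TipHarmonicLaw → ∀ (D : DobrushinDomain) (a b d : ℝ → Site 2) (d₀ : ℂ)
    (φ : ConformalEquiv upperHalfPlaneSet D.carrier) (x : ℝ) (ν : Measure (CurveClass ℂ)) [IsProbabilityMeasure ν],
    SAW.IsEndpointApprox D a b → d₀ ∈ frontier D.carrier → d₀ ≠ D.pt 0 → d₀ ≠ D.pt 1 →
    Tendsto (fun δ => meshPoint δ (d δ)) (𝓝[>] 0) (𝓝 d₀) →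
    (∀ᶠ δ in 𝓝[>] 0, (discreteDomainGraph D.carrier δ).Reachable (a δ) (d δ)) →
    D.IsChordalUniformizing φ → φ.HasBoundaryValue (x : ℂ) d₀ →
    IsSubseqLimitLaw (fun δ (γ : SAW.DomainSAW D.carrier δ (a δ) (b δ)) => γ.curve)
      (fun δ => SAW.law D.carrier δ (a δ) (b δ)) ν →
    (∀ᵐ c ∂ν, IsLoewnerDescribable φ c ∧ c.source = D.pt 0) →
    HarmonicLimitData φ x ν

/-- **(S2) Passage at generic levels.** For a chordal uniformizing map `φ`, a probability law `ν` carried by describable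
curves from `a`, and limit data `HarmonicLimitData φ x ν`: for every horizon `T`, all but countably many levels `ℓ > 0`
satisfy the cylinder identity `CylinderIdentityAt φ x ν ℓ T`. (The harmonic analogue of
`Loewner.integral_spinObservableProcess_cylinder_eq_zero_of_discreteMartingales`: a.e.-continuity of the level-`ℓ`
hitting time for all but countably many `ℓ`, continuity of the Loewner flow in the driver, an a.e.-continuous mapping
theorem, truncation, Doob optional sampling in pairing form.) -/
def GenericLevelPassage : Prop :=
  ∀ (D : DobrushinDomain) (φ : ConformalEquiv upperHalfPlaneSet D.carrier) (x : ℝ) (ν : Measure (CurveClass ℂ))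
    [IsProbabilityMeasure ν],
    D.IsChordalUniformizing φ → (∀ᵐ c ∂ν, IsLoewnerDescribable φ c ∧ c.source = D.pt 0) →
    HarmonicLimitData φ x ν →
    ∀ T : ℝ≥0, ∃ B : Set ℝ, B.Countable ∧ ∀ ℓ : ℝ, 0 < ℓ → ℓ ∉ B → CylinderIdentityAt φ x ν ℓ T

/-- **(S3) Level transfer.** For a chordal uniformizing map `φ` and a probability law `ν` carried by describable curves
from `a`: if the cylinder identity at horizon `T` holds at levels `ℓ′ > ℓ` accumulating at `ℓ > 0` (frequently in
`𝓝[>] ℓ`), then it holds at the level `ℓ` itself (`τ_{ℓ′} ↑ τ_ℓ`, time-continuity of the Loewner flow of `x` before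
swallowing, domination by `2 ℓ^{−5/4}`, measurability of the driving function, dominated convergence). -/
def LevelTransfer : Prop :=
  ∀ (D : DobrushinDomain) (φ : ConformalEquiv upperHalfPlaneSet D.carrier) (x : ℝ) (ν : Measure (CurveClass ℂ))
    [IsProbabilityMeasure ν],
    D.IsChordalUniformizing φ → (∀ᵐ c ∂ν, IsLoewnerDescribable φ c ∧ c.source = D.pt 0) →
    ∀ ℓ : ℝ, 0 < ℓ → ∀ T : ℝ≥0,
      (∃ᶠ ℓ' in 𝓝[>] ℓ, CylinderIdentityAt φ x ν ℓ' T) → CylinderIdentityAt φ x ν ℓ T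

/-! ## Registered stubs (`sorry` only here) -/

/-- **S1 `stub_latticeHarmonicData`** — `LatticeHarmonicData` (OPEN, XL; load-bearing). Foreseen split for the lead:
(J′-SAW) joint convergence in law of (SAW curve, capacity driver through `φ`) along the subsequence — KS17 Thm 1.5/Cor
1.7 output (iii), for which the only known engine is Condition G2 (no SAW technology; cf. the route's `LimitsDescribable`,
which keeps only output (ii)); (D-SAW) K58 + tip kernel convergence + UI ⇒ the discrete martingale data. Cheapest
falsifier: none finite (limit statement); a proof that subsequential SAW limits charge curves with boundary touchings
of positive `ν`-mass would break (J′-SAW) as typed through `drivingFunction φ`. -/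
theorem stub_latticeHarmonicData : LatticeHarmonicData := by
  sorry

/-- **S2 `stub_genericLevelPassage`** — `GenericLevelPassage` (provable in kind, L/XL). The one new ingredient over the
tree's spin passage: for a continuous path `w` the functional `w′ ↦ levelTime w′ x ℓ T` is continuous at `w` whenever
`ℓ′ ↦ levelTime w x ℓ′ T` is continuous at `ℓ` (lower semicontinuity always; upper from a strictly lower level reached
shortly after), and for each law the latter fails for at most countably many `ℓ` (jumps of the monotone map
`ℓ ↦ E[arctan levelTime]`). Degenerate cases: `|x| ≤ ℓ` ⇒ `levelTime = 0` and the integrand vanishes identically. -/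
theorem stub_genericLevelPassage : GenericLevelPassage := by
  sorry

/-- **S3 `stub_levelTransfer`** — `LevelTransfer` (provable now, M/L). Route: extract `ℓ_j ↓ ℓ` with the identity at
`(ℓ_j, T)`; for every curve class `c` (the driving function is continuous even in the junk case,
`continuous_drivingFunction`) `levelTime W x ℓ_j T ↑ levelTime W x ℓ T` and `u ↦ harmonicObs W x u` is continuous on
`[0, levelTime W x ℓ T]` (gap `≥ ℓ > 0` there; `Loewner.map` is an integral curve in time before swallowing); the
integrands are measurable (`measurable_drivingFunction hφ` and Borel functionals of the path) and bounded by
`2 ℓ^{−5/4}`; `tendsto_integral_of_dominated_convergence` and uniqueness of limits. -/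
theorem stub_levelTransfer : LevelTransfer := by
  sorry

/-! ### Name-keyed aliases of the three statements — the hypotheses of `HarmonicPassage_of`

The native skeleton audit (`#h21_check_skeleton`) admits a hypothesis of the skeleton theorem only if its head constant
is a registered obligation or is NAMED like a declared stub; `__Registered.stub_X` is the statement of `stub_X` under that
name (device of `Cruxes/AxiomsOfLimit/Lines/birth.lean` and `Cruxes/LimitAxioms/Lines/birth.lean`; the gate-reserved
`@[stub]` attribute is not written by a planner). Each alias is `rfl`-equal to its statement. -/
namespace __Registered

/-- Alias of `LatticeHarmonicData` keyed by the registered stub name. -/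
abbrev stub_latticeHarmonicData : Prop := LatticeHarmonicData
/-- Alias of `GenericLevelPassage` keyed by the registered stub name. -/
abbrev stub_genericLevelPassage : Prop := GenericLevelPassage
/-- Alias of `LevelTransfer` keyed by the registered stub name. -/
abbrev stub_levelTransfer : Prop := LevelTransfer

end __Registered

/-! ## The skeleton theorem: the three stubs imply the crux, BY NAME (kernel-checked, no `sorry` of its own) -/

/-- **`HarmonicPassage` from the line `birth`.** S1 gives the limit data for the crux's `(φ, x, ν)`; S2 gives, for the
horizon `m + 1`, a countable exceptional set of levels; its complement is dense (`Set.Countable.dense_compl`), so the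
identity holds frequently at levels just above `1/(m+1)`; S3 transfers it to the level `1/(m+1)`; this is the crux's
conclusion once its four `let`s are ζ-reduced (`gapPath`/`harmonicObs`/`levelTime`/`stoppedObs` unfold to the crux's
`gap`/`N`/`τ`). Hypotheses = the three stubs under their registered names; conclusion = the route decl, by name. -/
theorem HarmonicPassage_of (hData : __Registered.stub_latticeHarmonicData)
    (hPass : __Registered.stub_genericLevelPassage) (hLev : __Registered.stub_levelTransfer) :
    Summit.CriticalPhenomena.SAWScalingLimit.Theses.SAWLaplacianWalk.HarmonicPassage := by
  intro hK D a b d d₀ φ x ν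
  dsimp only
  intro hab hd₀ hd₀a hd₀b hdt hdr hφ hbv hν hsub hdesc m s t hst n S hS ψ hψc hψb
  -- S1: the limit data of the crux's `(φ, x, ν)`
  have hdata : HarmonicLimitData φ x ν :=
    hData hK D a b d d₀ φ x ν hab hd₀ hd₀a hd₀b hdt hdr hφ hbv hsub hdesc
  -- S2: all but countably many levels are good for the horizon `m + 1`
  obtain ⟨B, hBc, hgood⟩ := hPass D φ x ν hφ hdesc hdata ((m : ℝ≥0) + 1)
  -- the crux's level
  have hℓ : (0 : ℝ) < 1 / ((m : ℝ) + 1) := by positivity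
  -- good levels accumulate at `1/(m+1)` from above: a countable set has dense complement
  have hfreq : ∃ᶠ ℓ' in 𝓝[>] (1 / ((m : ℝ) + 1)), CylinderIdentityAt φ x ν ℓ' ((m : ℝ≥0) + 1) := by
    rw [Filter.frequently_iff]
    intro U hU
    obtain ⟨u, hu, hUsub⟩ := mem_nhdsGT_iff_exists_Ioo_subset.1 hU
    obtain ⟨ℓ', hℓ'B, hℓ'I⟩ :=
      (Set.Countable.dense_compl ℝ hBc).exists_mem_open isOpen_Ioo (nonempty_Ioo.2 hu)
    exact ⟨ℓ', hUsub hℓ'I, hgood ℓ' (hℓ.trans hℓ'I.1) hℓ'B⟩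
  -- S3: transfer to the level `1/(m+1)` itself, then read off the instance `(s, t, S, ψ)`
  exact hLev D φ x ν hφ hdesc (1 / ((m : ℝ) + 1)) hℓ ((m : ℝ≥0) + 1) hfreq s t hst n S hS ψ hψc hψb

/-- Wiring check (an `example`, so that `HarmonicPassage_of` stays the only theorem concluding the crux): the registered
stubs feed the skeleton theorem as stated — this term becomes the crux proof when the three `sorry`s are discharged. -/
example : Summit.CriticalPhenomena.SAWScalingLimit.Theses.SAWLaplacianWalk.HarmonicPassage :=
  HarmonicPassage_of stub_latticeHarmonicData stub_genericLevelPassage stub_levelTransfer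

/-- Shape check: the crux's conclusion at level index `m` is literally `CylinderIdentityAt φ x ν (1/(m+1)) (m+1)`
instantiated at `(s, t, S, ψ)` (definitional unfolding only). -/
example (φ : ConformalEquiv upperHalfPlaneSet D.carrier) (x : ℝ) (ν : Measure (CurveClass ℂ)) (m : ℕ)
    (h : CylinderIdentityAt φ x ν (1 / ((m : ℝ) + 1)) ((m : ℝ≥0) + 1)) (s t : ℝ≥0) (hst : s ≤ t) :
    ∀ (n : ℕ) (S : Fin n → ℝ≥0), (∀ k, S k ≤ s) → ∀ ψ : (Fin n → ℝ) → ℝ, Continuous ψ → (∀ v, |ψ v| ≤ 1) →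
      ∫ c, (harmonicObs (drivingFunction φ c) x
              (min t (sInf ({r : ℝ≥0 | |gapPath (drivingFunction φ c) x r| ≤ 1 / ((m : ℝ) + 1)} ∪
                {(m : ℝ≥0) + 1}))) -
            harmonicObs (drivingFunction φ c) x
              (min s (sInf ({r : ℝ≥0 | |gapPath (drivingFunction φ c) x r| ≤ 1 / ((m : ℝ) + 1)} ∪
                {(m : ℝ≥0) + 1})))) *
          ψ (fun k => drivingFunction φ c (S k)) ∂ν = 0 :=
  h s t hst

end Summit.CriticalPhenomena.SAWScalingLimit.Cruxes.HarmonicPassage.Birth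

end
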